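import Mathlib
import Literature.NumberTheory.Transcendental.LandauDefectLatticeTate
import Literature.NumberTheory.Transcendental.AxSchanuel
import Literature.NumberTheory.Transcendental.RosenlichtProp4Residues
import Summits.KontsevichZagierPeriods.KontsevichZagierPeriods.Theses.InverseLandau
import Summits.KontsevichZagierPeriods.KontsevichZagierPeriods.Theorems.InverseLandauInverseLandauRationalCurves

/-!
# Line `InverseLandauSeparableSurfaces` on crux `TateFamilyKernel` (stmt-KontsevichZagierPeriods-9130)
# — the NEXT RUNG of the route's formal ladder: inverse Landau for SEPARABLE Tate surfaces (dimension 1 → 2)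

Forward generator G1 (seed `g1-KontsevichZagierPeriods-13872`, floor = the PROVED item 13872
`…Theses.InverseLandau.InverseLandauRationalCurves`, closed by
`Summit.KontsevichZagierPeriods.InverseLandau.RationalCurves.InverseLandauRationalCurves_of`), typed and
witnessed by seat `fwd-rung-KontsevichZagierPeriods-02`, filed as a line by `fwd-harvest-KontsevichZagierPeriods-02`.

* `rung_decl  = Summit.KontsevichZagierPeriods.InverseLandau.SeparableSurfaces.InverseLandauSeparableSurfaces`
  (= `Rung 2` of the graded family `Rung : ℕ → Prop`; `Rung 1` = the floor, by definition).
* `witness    = Lines/InverseLandauSeparableSurfaces_special.lean` (`example : Rung 1 := by simpa [Rung] using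
  …InverseLandauRationalCurves_of`, rc 0, no sorry).
* what it advances on the crux: the formal (Tate-point) kernel theorem for the separable sector
  `Q = Q₁(z₁,ϖ)·Q₂(z₂,ϖ)` of `TateFamilyKernel` in dimension `n = 2` — the COMPLETENESS statement behind the
  lead's census conjecture `V_Q = Exact + Transport + Sym + Products` for an infinite class, and it exhibits the
  relator kind the `Ω_Q`-local census cannot see (period-matched antisymmetric pairs over the JOINT pole set;
  crux idea `Ideas/separable-tensor-square.md`). Its absolute shadow (fibres at real-algebraic `ϖ₀` are KZ
  relations) is then one swap move (`stub_hyperoctahedral`, landed) plus products with one-variable null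
  factors over the joint pole set (`StubProductIntegral`/`stub_glueProduct` + items 9132/9135), cf. LADDER R2′.

## The rung (statement, verbatim from the source seat's Sketch.lean)

For `F = P(z,w,ϖ)/(Q₁(z,ϖ)·Q₂(w,ϖ))` with both `Qᵢ ∈ k[x][ϖ]` Tate (`Qᵢ(·,0) = cᵢ ≠ 0`) and the termwise
`∫∫_{[0,1]²}` of the `ϖ`-expansion vanishing, over every algebraically closed `K ⊇ k(ϖ)` the tensor
`F^⊗ = Σ P_ab · (x^a/Q₁) ⊗ (x^b/Q₂) ∈ K(x) ⊗_K K(x)` is a finite sum of PERIOD-MATCHED ANTISYMMETRIC PAIRS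
`f ⊗ g − f′ ⊗ g′` with `f − g′`, `f′ − g` NULL one-variable forms (the floor's normal form: exact with equal
endpoint values + loop relators indexed by exact multiplicative relations among the Landau units
`g_p = (p−1)/p`) for the JOINT pole set `S = roots(Q₁·Q₂)`.

## Skeleton (3 registered stubs; the composition `InverseLandauSeparableSurfaces_of` is proved from two of them)

* `stub_periodPairing` — LOAD-BEARING TRANSFER (analysis → linear algebra). Under the rung's hypotheses there
  is a PERIOD PAIRING for the joint pole set: a finite-dimensional `K`-subspace `V ≤ K(x)` carrying a preimage
  `t₀ ∈ V ⊗ V` of `F^⊗`, a commutative `K`-algebra `A`, a `K`-linear period map `π : V → A` and a subspace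
  `W ≥ range π` with (i) `Sym²`-INJECTIVITY of multiplication on `W` (bilinear Ax, `stub_bilinearAx`),
  (ii) `ker π ⊆` null forms for `S` (the FLOOR on the joint pole set: `Q₁·Q₂` is again a one-variable Tate
  denominator, item 13872; plus linear Ax / Rosenlicht for `K`-rational coefficients), (iii) `μ ∘ (π ⊗ π)`
  kills `t₀` (two-variable Tate expansion calculus = Cauchy product of the floor's one-variable calculi,
  and the termwise-vanishing hypothesis). Two models: `A = K ⊗_{K′} K′_c` (completion of the splitting field
  `K′` of `Q₁Q₂` at a place over `ϖ = 0`, `Landau.Place.exists_val_X_lt_one`, with formal logarithms of the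
  principal units `g_p`, `landauDatum_mem_principalUnits`; `π(f) = E(1) − E(0) + Σ_p res_p(f)·Log g_p`), or
  log-free `A = K ⊗_{k(ϖ)} k((ϖ))` with `π = id ⊗ (expansion period)` as in the floor's proof
  (Theorems/InverseLandauInverseLandauRationalCurves*.lean), where (ii) is the floor's STATEMENT applied to the
  Tate family `(h(ϖ)·P_f, Q₁Q₂)` and Galois descent of the null space.
* `stub_pairNormalForm` — pure linear algebra of the tensor square (verbatim from the source seat): the kernel
  of `f ⊗ g ↦ π(f)·π(g)` is spanned by period-matched antisymmetric pairs once `Sym²` of the period space embeds.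
* `stub_bilinearAx` — registered TOOL stub (verbatim from the source seat; feeds (i) of `stub_periodPairing`,
  not used by the composition): in a differential field, a `K₀`-quadratic relation among logarithms that are
  `ℚ`-independent modulo constants, with `trdeg_C K₀ ≤ 1`, is trivial — from `ax_schanuel_holds` (in tree).

Hardest stub: `stub_periodPairing` (M–L: the period-map construction over an abstract algebraically closed
`K ⊇ k(ϖ)` by base change from the splitting field; everything else is the floor's machinery per variable).
Barriers: functional statement at the Tate point — `GrothendieckPeriodConjectureDependence` /
`kzConjecture_implies_*AlgIndep` not engaged (no values), `noSemialgebraicPrimitive_inv_sub_two` evaded (no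
primitives taken); BC9 ceiling of the method family (functional transcendence + Landau analysis) = RELATIVE
statements; lift = `TateLifting` (9129). Disproof used: none exists for 9130 (`ledger crux ls`). Dead lines
avoided: not the retired SmallParameterTransfer/TateTransport split (no radius, no transport in `ϖ`), not the
refuted `m = 0` trichotomy (a tensor-square statement with joint-lattice null forms, not a family trichotomy).
-/

noncomputable section

open Polynomial
open scoped TensorProduct
open Literature.NumberTheory.Transcendental Literature.NumberTheory.Transcendental.AyoubRel

namespace Summit.KontsevichZagierPeriods.InverseLandau.SeparableSurfaces

/-! ## The rung and its graded family (verbatim from the source seat's `Sketch.lean`, rc 0) -/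

/-- NULL ONE-VARIABLE FORMS (the floor's normal form as a predicate). For a finite set `S ⊆ K` of pole branches,
`f ∈ K(x)` is null iff `f = (A/B)′ + Σ_q c_q Σ_{p ∈ S} n_{q,p}/(x − p)` with `B(0)B(1) ≠ 0`, `A(1)B(0) = A(0)B(1)`
(equal endpoint values of the exact part) and every `n_q ∈ ℤ^S` an EXACT multiplicative relation among the Landau
functions `g_p = (p−1)/p` (`Landau.relationLattice`); such a form has formal period `0` at a Tate point. -/
def IsNullForm (K : Type) [Field K] (S : Set K) [Fintype S] (f : RatFunc K) : Prop :=
  ∃ (A B : Polynomial K) (s : ℕ) (c : Fin s → K) (nv : Fin s → (S → ℤ)),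
    B.eval 0 ≠ 0 ∧ B.eval 1 ≠ 0 ∧ A.eval 1 * B.eval 0 = A.eval 0 * B.eval 1 ∧
    (∀ q, nv q ∈ Landau.relationLattice (fun p : S => landauUnit K (p : K))) ∧
    f = algebraMap (Polynomial K) (RatFunc K) (derivative A * B - A * derivative B) /
          algebraMap (Polynomial K) (RatFunc K) (B ^ 2) +
        ∑ q, RatFunc.C (c q) * ∑ p : S, RatFunc.C ((nv q p : ℤ) : K) * (RatFunc.X - RatFunc.C (p : K))⁻¹

/-- Termwise box integral `∫∫_{[0,1]²} z^a w^b dz dw = 1/((a+1)(b+1))`, extended `k`-linearly. -/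
def boxIntegral {k : Type} [Field k] (p : MvPolynomial (Fin 2) k) : k :=
  ∑ m ∈ p.support, MvPolynomial.coeff m p * ∏ i, ((m i : k) + 1)⁻¹

/-- The tensor `Σ_{(a,b)} P_{ab} · (x^a/D₁) ⊗ (x^b/D₂) ∈ K(x) ⊗_K K(x)` attached to a numerator
`P ∈ K[z,w]` (`z = X 0`, `w = X 1`) and two one-variable denominators `D₁, D₂ ∈ K[x]`: the separable integrand
`P(z,w)/(D₁(z)D₂(w))` read in the tensor square of the one-variable function field. -/
def boxTensor (K : Type) [Field K] (P : MvPolynomial (Fin 2) K) (D₁ D₂ : Polynomial K) :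
    RatFunc K ⊗[K] RatFunc K :=
  ∑ m ∈ P.support, MvPolynomial.coeff m P •
    ((RatFunc.X ^ (m 0) / algebraMap (Polynomial K) (RatFunc K) D₁) ⊗ₜ[K]
      (RatFunc.X ^ (m 1) / algebraMap (Polynomial K) (RatFunc K) D₂))

/-- **RUNG (n = 2, separable denominators): inverse Landau for separable Tate surfaces.**
Data: a field `k` of characteristic `0`; two one-variable Tate denominators `Q₁, Q₂ ∈ k[x][ϖ]`
(`Qᵢ.coeff 0 = C cᵢ`, `cᵢ ≠ 0`); a numerator `P ∈ k[z,w][ϖ]` (`MvPolynomial (Fin 2) k` coefficients, `z = X 0`,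
`w = X 1`); the `ϖ`-expansion `G ∈ k[z,w][[ϖ]]` of `F = P/(Q₁(z)Q₂(w))`. Hypothesis: every `ϖ`-coefficient of `G`
has vanishing box integral. Conclusion: over every algebraically closed `K ⊇ k(ϖ)`, with `S ⊆ K` the roots of
`Q₁·Q₂` (the JOINT pole set, both read as polynomials in the one variable `x`), the tensor
`F^⊗ = Σ_{(a,b)} P_{ab} · (x^a/Q₁) ⊗ (x^b/Q₂)` is a finite sum `Σ_i (f_i ⊗ g_i − f′_i ⊗ g′_i)` with `f_i − g′_i`
and `f′_i − g_i` null forms for `S`. (Products with one null factor are the pairs with `f′ = g, g′ = 0` or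
`f′ = 0, g′ = f`; the genuinely two-dimensional relators are the norm-matched antisymmetric pairs.) -/
def InverseLandauSeparableSurfaces : Prop :=
  ∀ (k : Type) [Field k] [CharZero k] (Q₁ Q₂ : Polynomial (Polynomial k)) (c₁ c₂ : k),
    c₁ ≠ 0 → c₂ ≠ 0 → Q₁.coeff 0 = Polynomial.C c₁ → Q₂.coeff 0 = Polynomial.C c₂ →
  ∀ (P : Polynomial (MvPolynomial (Fin 2) k)) (G : PowerSeries (MvPolynomial (Fin 2) k)),
    ((Q₁.map (Polynomial.aeval (MvPolynomial.X 0 : MvPolynomial (Fin 2) k)).toRingHom :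
          PowerSeries (MvPolynomial (Fin 2) k)) *
        (Q₂.map (Polynomial.aeval (MvPolynomial.X 1 : MvPolynomial (Fin 2) k)).toRingHom :
          PowerSeries (MvPolynomial (Fin 2) k)) * G = (P : PowerSeries (MvPolynomial (Fin 2) k))) →
    (∀ j : ℕ, boxIntegral (PowerSeries.coeff j G) = 0) →
  ∀ (K : Type) [Field K] [IsAlgClosed K] [Algebra (RatFunc k) K],
    ∃ (s : ℕ) (f g f' g' : Fin s → RatFunc K),
      (∀ i, IsNullForm K (((TateFamily₁.toParamPoly Q₁).map (algebraMap (RatFunc k) K) *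
              (TateFamily₁.toParamPoly Q₂).map (algebraMap (RatFunc k) K)).rootSet K) (f i - g' i) ∧
            IsNullForm K (((TateFamily₁.toParamPoly Q₁).map (algebraMap (RatFunc k) K) *
              (TateFamily₁.toParamPoly Q₂).map (algebraMap (RatFunc k) K)).rootSet K) (f' i - g i)) ∧
      boxTensor K
          (P.eval₂ (MvPolynomial.map ((algebraMap (RatFunc k) K).comp (algebraMap k (RatFunc k))))
            (MvPolynomial.C (algebraMap (RatFunc k) K RatFunc.X)))
          ((TateFamily₁.toParamPoly Q₁).map (algebraMap (RatFunc k) K))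
          ((TateFamily₁.toParamPoly Q₂).map (algebraMap (RatFunc k) K))
        = ∑ i, (f i ⊗ₜ[K] g i - f' i ⊗ₜ[K] g' i)

/-- The graded family by DIMENSION of the box (the carrier types change with `n`, so the family is defined by
cases): `Rung 1` is the floor (the parent route's decl, PROVED as item 13872), `Rung 2` the separable-surface rung,
`Rung 0` (no variables) is empty of content. Dimensions `≥ 3` of the separable family (`n`-fold products,
`Symⁿ`/`Λ` bookkeeping over `⨂ K(x_i)`, Ax–Schanuel in transcendence degree `n`; LADDER.md R3–R6) are NOT typed
yet: the placeholder is `True`, i.e. NO claim (the source seat's `opaque RungHigher` is not accepted in crux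
files), chosen so that `∀ n, Rung n` is exactly the typed content `Rung 1 ∧ Rung 2` and nothing vacuous can be
built on the family. -/
def Rung : ℕ → Prop
  | 0 => True
  | 1 => Summit.KontsevichZagierPeriods.KontsevichZagierPeriods.Theses.InverseLandau.InverseLandauRationalCurves
  | 2 => InverseLandauSeparableSurfaces
  | (_ + 3) => True

/-! ## Registered stubs -/

/-- **Stub 1 — bilinear Ax (the new transcendence input; TOOL stub, feeds clause (i) of `stub_periodPairing`).**
In a differential field `(L, D)` of characteristic `0` with constants `C`, let `g₁,…,gₙ ∈ Lˣ` have logarithms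
`ℓᵢ` (`D gᵢ = gᵢ · D ℓᵢ`) that are `ℚ`-linearly independent modulo `C`, and let `K₀ ⊆ L` be a `C`-subalgebra of
transcendence degree `≤ 1` over `C` containing the `gᵢ` (in the application: `K₀ = k_c(ϖ)^alg ∩ L` inside the
completion `L = K′_c` at a place over `ϖ = 0`). Then a `K₀`-quadratic expression in the `ℓᵢ` vanishes only
trivially: symmetrised degree-2 coefficients, degree-1 coefficients and the constant all vanish. (From
`ax_schanuel_holds`: `trdeg_C C(ℓ, g) ≥ n + 1`, and `trdeg_C K₀ ≤ 1` forces `ℓ₁,…,ℓₙ` algebraically independent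
over `K₀`.) [cite: Ax1971, Thm. 3] -/
theorem stub_bilinearAx {L : Type} [Field L] [CharZero L] (D : Derivation ℤ L L)
    {n : ℕ} (g : Fin n → Lˣ) (ℓ : Fin n → L)
    (hexp : ∀ i, D (g i : L) = (g i : L) * D (ℓ i))
    (hind : IsQLinearIndependentMod (fun _ : Fin 1 => D) ℓ)
    (K₀ : Subalgebra (constantSubring (fun _ : Fin 1 => D)) L)
    (hK₀ : Algebra.trdeg (constantSubring (fun _ : Fin 1 => D)) K₀ ≤ 1)
    (hg : ∀ i, (g i : L) ∈ K₀)
    (υ : L) (σ : Fin n → L) (ρ : Fin n → Fin n → L)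
    (hυ : υ ∈ K₀) (hσ : ∀ i, σ i ∈ K₀) (hρ : ∀ i j, ρ i j ∈ K₀)
    (h0 : υ + ∑ i, σ i * ℓ i + ∑ i, ∑ j, ρ i j * (ℓ i * ℓ j) = 0) :
    (∀ i j, ρ i j + ρ j i = 0) ∧ (∀ i, σ i = 0) ∧ υ = 0 := by
  sorry

/-- **Stub 2 — pair normal form (linear algebra of the tensor square; used by the composition).** Let
`π : V → A` be a `K`-linear "period map" into a commutative `K`-algebra whose image lies in a subspace `W ≤ A`
on which multiplication is `Sym²`-injective (products `w_i w_j`, `i ≤ j`, of a linearly independent family in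
`W` stay linearly independent). Then every tensor `t ∈ V ⊗_K V` killed by `f ⊗ g ↦ π(f)·π(g)` is a finite sum of
PERIOD-MATCHED ANTISYMMETRIC PAIRS `f ⊗ g − f′ ⊗ g′` with `π(f − g′) = π(f′ − g) = 0`. (Proof sketch:
`ker = ker π ⊗ V + V ⊗ ker π + (π⊗π)⁻¹(Λ²(im π))`; products with a null factor are the pairs with
`g′ = 0, f′ = g` resp. `f′ = 0, g′ = f`, and `c ⊗ c′ − c′ ⊗ c` lifts to a matched pair.) [folklore] -/
theorem stub_pairNormalForm {K A V : Type} [Field K] [CommRing A] [Algebra K A]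
    [AddCommGroup V] [Module K V] [FiniteDimensional K V]
    (π : V →ₗ[K] A) (W : Submodule K A) (hπW : LinearMap.range π ≤ W)
    (hSym : ∀ (m : ℕ) (w : Fin m → A), (∀ i, w i ∈ W) → LinearIndependent K w →
      LinearIndependent K (fun p : {p : Fin m × Fin m // p.1 ≤ p.2} => w p.1.1 * w p.1.2))
    (t : V ⊗[K] V) (ht : (LinearMap.mul' K A ∘ₗ TensorProduct.map π π) t = 0) :
    ∃ (s : ℕ) (f g f' g' : Fin s → V),
      (∀ i, π (f i - g' i) = 0 ∧ π (f' i - g i) = 0) ∧ t = ∑ i, (f i ⊗ₜ[K] g i - f' i ⊗ₜ[K] g' i) := by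
  sorry

/-- **Stub 3 — the period pairing for the joint pole set (LOAD-BEARING transfer; used by the composition).**
Under the hypotheses of the rung, over every algebraically closed `K ⊇ k(ϖ)` there exist: a finite-dimensional
`K`-subspace `V ≤ K(x)` and a tensor `t₀ ∈ V ⊗_K V` mapping to `F^⊗` in `K(x) ⊗_K K(x)`; a commutative
`K`-algebra `A` (the period algebra), a `K`-linear period map `π : V → A` and a subspace `W ≤ A` containing its
range, such that (i) multiplication is `Sym²`-injective on `W` (bilinear Ax, `stub_bilinearAx`, for
`W = K ⊗ (K′·1 ⊕ ⊕_l K′·Log u_l)`), (ii) every `v ∈ V` with `π v = 0` is a NULL form for the joint pole set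
`S = roots(Q₁·Q₂)` (the floor 13872 on the one-variable Tate denominator `Q₁·Q₂`, with linear Ax / Galois
descent for `K`-rational coefficients), and (iii) `μ ∘ (π ⊗ π)` kills `t₀` (two-variable Tate expansion
calculus: the formal double period of `F` is the Cauchy product of the one-variable expansion periods, i.e.
`Σ_J ϖ^J · boxIntegral (coeff_J G) = 0`). Models: `A = K ⊗_{K′} K′_c` with formal logarithms at a place of the
splitting field `K′ ∋ S` over `ϖ = 0` (`Landau.Place.exists_val_X_lt_one`, `landauDatum_mem_principalUnits`),
or log-free `A = K ⊗_{k(ϖ)} k((ϖ))`, `π = id ⊗ (expansion period)` as in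
Theorems/InverseLandauInverseLandauRationalCurves*.lean. [cite: AyoubRelKZRevisited, §1.2] [cite: Ax1971, Thm. 3] -/
theorem stub_periodPairing :
    ∀ (k : Type) [Field k] [CharZero k] (Q₁ Q₂ : Polynomial (Polynomial k)) (c₁ c₂ : k),
      c₁ ≠ 0 → c₂ ≠ 0 → Q₁.coeff 0 = Polynomial.C c₁ → Q₂.coeff 0 = Polynomial.C c₂ →
    ∀ (P : Polynomial (MvPolynomial (Fin 2) k)) (G : PowerSeries (MvPolynomial (Fin 2) k)),
      ((Q₁.map (Polynomial.aeval (MvPolynomial.X 0 : MvPolynomial (Fin 2) k)).toRingHom :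
            PowerSeries (MvPolynomial (Fin 2) k)) *
          (Q₂.map (Polynomial.aeval (MvPolynomial.X 1 : MvPolynomial (Fin 2) k)).toRingHom :
            PowerSeries (MvPolynomial (Fin 2) k)) * G = (P : PowerSeries (MvPolynomial (Fin 2) k))) →
      (∀ j : ℕ, boxIntegral (PowerSeries.coeff j G) = 0) →
    ∀ (K : Type) [Field K] [IsAlgClosed K] [Algebra (RatFunc k) K],
      ∃ (V : Submodule K (RatFunc K)) (_ : FiniteDimensional K V) (t₀ : V ⊗[K] V)
        (A : Type) (_ : CommRing A) (_ : Algebra K A) (π : V →ₗ[K] A) (W : Submodule K A),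
        LinearMap.range π ≤ W ∧
        (∀ (m : ℕ) (w : Fin m → A), (∀ i, w i ∈ W) → LinearIndependent K w →
          LinearIndependent K (fun p : {p : Fin m × Fin m // p.1 ≤ p.2} => w p.1.1 * w p.1.2)) ∧
        (∀ v : V, π v = 0 →
          IsNullForm K (((TateFamily₁.toParamPoly Q₁).map (algebraMap (RatFunc k) K) *
              (TateFamily₁.toParamPoly Q₂).map (algebraMap (RatFunc k) K)).rootSet K) (v : RatFunc K)) ∧
        TensorProduct.map V.subtype V.subtype t₀ =
          boxTensor K
            (P.eval₂ (MvPolynomial.map ((algebraMap (RatFunc k) K).comp (algebraMap k (RatFunc k))))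
              (MvPolynomial.C (algebraMap (RatFunc k) K RatFunc.X)))
            ((TateFamily₁.toParamPoly Q₁).map (algebraMap (RatFunc k) K))
            ((TateFamily₁.toParamPoly Q₂).map (algebraMap (RatFunc k) K)) ∧
        (LinearMap.mul' K A ∘ₗ TensorProduct.map π π) t₀ = 0 := by
  sorry

/-! ## The composition: the rung from the stubs (no sorry outside the stubs) -/

/-- **The rung from the stubs.** Transfer to the period pairing (`stub_periodPairing`), decompose the killed
tensor into period-matched antisymmetric pairs inside `V ⊗ V` (`stub_pairNormalForm`), push the decomposition
forward along `V ↪ K(x)`, and read `π(f − g′) = 0` as "null form" through clause (ii). -/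
theorem InverseLandauSeparableSurfaces_of : InverseLandauSeparableSurfaces := by
  intro k _ _ Q₁ Q₂ c₁ c₂ hc₁ hc₂ hQ₁ hQ₂ P G hG hint K _ _ _
  obtain ⟨V, hV, t₀, A, _instA, _instKA, π, W, hπW, hSym, hker, ht₀, hvan⟩ :=
    stub_periodPairing k Q₁ Q₂ c₁ c₂ hc₁ hc₂ hQ₁ hQ₂ P G hG hint K
  haveI : FiniteDimensional K V := hV
  obtain ⟨s, f, g, f', g', hnull, hdec⟩ := stub_pairNormalForm π W hπW hSym t₀ hvan
  refine ⟨s, fun i => (f i : RatFunc K), fun i => (g i : RatFunc K), fun i => (f' i : RatFunc K),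
    fun i => (g' i : RatFunc K), fun i => ?_, ?_⟩
  · obtain ⟨h₁, h₂⟩ := hnull i
    refine ⟨?_, ?_⟩
    · have h := hker _ h₁
      rwa [Submodule.coe_sub] at h
    · have h := hker _ h₂
      rwa [Submodule.coe_sub] at h
  · rw [← ht₀, hdec, map_sum]
    refine Finset.sum_congr rfl fun i _ => ?_
    rw [map_sub, TensorProduct.map_tmul, TensorProduct.map_tmul]
    rfl

/-- `Rung 2` of the graded family, from the stubs. -/
theorem rung_two_of : Rung 2 := InverseLandauSeparableSurfaces_of

/-- `Rung 1` is the PROVED floor (item 13872) — the F3 witness, repeated here so the line file records it. -/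
theorem rung_one : Rung 1 :=
  Summit.KontsevichZagierPeriods.InverseLandau.RationalCurves.InverseLandauRationalCurves_of

end Summit.KontsevichZagierPeriods.InverseLandau.SeparableSurfaces

end
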